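import Mathlib
import HarnessLib
import Summits.Ventures.LatticeQCDFlow.Scaling.KernelMarginalMTP2

/-!
# LatticeQCDFlow / Scaling — STRICT MTP₂ marginals I: the strict four-point step, strict
# integration, and strict two-point squares surviving the integration of unrelated coordinates

HONEST FRAMING: exact (Metropolis-corrected) sampling algorithms for lattice gauge theory;
figures of merit are autocorrelation/cost numbers at stated couplings and volumes; no
continuum-physics claim.

Venture `LatticeQCDFlow` (cell pub-lqcd), topic `Scaling`, FANOUT row 30 (lean-1, GEN-17) — OUR WORK, the
strict half of `Scaling/KernelMarginalMTP2` and the engine of THEORY-2 §4 C5 ('the exact autoregressive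
conditional is faithful THROUGH the integrated block') in EVERY dimension (`KernelCompositionTP2` did one
dimension by composing kernels along a path; in `d ≥ 2` the path sites keep neighbours off the path and
one needs strictness to survive further integrations).  Language: for a weight `w` on `κ → X` the PURE
`(a, j)`-SQUARE at base `z` is the quadruple `z[a↦α][j↦β'], z[a↦α'][j↦β], z[a↦α'][j↦β'], z[a↦α][j↦β]`
(`α < α'`, `β < β'`); "strict pure squares" = `w` of the first two multiplied is `<` `w` of the last two
(strict TP₂ in the pair with everything else frozen).

* §1 **`fourPoint_lt`**, **`fourPoint_lt'`** — strict forms of the Ahlswede–Daykin four-point step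
  (`a, b ≤ U`, `ab < UV` or `a, b < U`, `ab ≤ UV` ⇒ `a + b < U + V`); **`mtp2_integrand_lt_of_diag`** /
  **`mtp2_integrand_lt_of_offdiag`** — the symmetrised MTP₂ integrand inequality of
  `KernelMarginalMTP2.mtp2_integrand_le` is strict as soon as its diagonal terms, resp. its two crossed
  terms, are strict.
* §2 **`mtp2_integral_lt`** — `(∫F x)(∫F y) < (∫F (x⊔y))(∫F (x⊓y))` for jointly MTP₂ `F ≥ 0` whose
  symmetrised integrand inequality is strict on a set of positive `μ ⊗ μ` measure.
* §3 **`pureSq_coordAvg_singleton`** — STRICT PURE SQUARES SURVIVE INTEGRATING AN UNRELATED COORDINATE: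
  `w ≥ 0` bounded measurable MTP₂ with strict pure `(a, j)`-squares, `k ∉ {a, j}` ⇒ `A_k w` has strict
  pure `(a, j)`-squares (any reference probability measure); bookkeeping `coordAvg_singleton_pos`,
  `coordAvg_pos` (partial averages of positive weights are positive), `coordAvg_update_of_mem` (`A_T`
  does not read coordinates in `T`), `update3_comm`, `upd2_sup_upd2` / `upd2_inf_upd2`.

* §4 `gaussianBond_stp2` / `gaussianBond_tp2` / `gaussianBond_props` — the standard instance: the
  Gaussian / gradient bond `exp(−κ(u−x)²/2)` on `ℝ` is strictly TP₂ for `κ > 0` (TP₂ for `κ ≥ 0`),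
  positive, bounded by `1`, jointly measurable.

Sequel `Scaling/KernelMarginalSMTP2Chain`: strict links COMPOSE through an integrated coordinate and
propagate along integrated chains; `Scaling/AutoregressiveBlockFaithful`: the ferromagnet application
(C5 in every dimension).  NOT CLAIMED here: anything about a specific model; any number of ours.
Literature grade (cell rule): known mechanism (Karlin–Rinott 1980 §3 for the non-strict statements) —
the strict bookkeeping is ours and elementary; nothing is cited as a fact; no `def`; no `sorry`.
-/

noncomputable section

namespace Summit.Ventures.LatticeQCDFlow.Theory2.Autoregressive

open MeasureTheory Function Set
open Summit.Ventures.LatticeQCDFlow.Exactness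

/-! ## §1 The strict four-point step and the strict integrand inequalities -/

/-- **Strict four-point step, diagonal form**: `a, b ≤ U`, `a·b < U·V`, `a ≥ 0` ⇒ `a + b < U + V`.
[folklore: Ahlswede–Daykin; ours in this strict form] -/
theorem fourPoint_lt {a b U V : ℝ} (ha : 0 ≤ a) (haU : a ≤ U) (hbU : b ≤ U)
    (habUV : a * b < U * V) : a + b < U + V := by
  have hU : 0 < U := by
    rcases eq_or_lt_of_le (le_trans ha haU) with h | h
    · exfalso
      have ha0 : a = 0 := le_antisymm (h ▸ haU) ha
      rw [ha0, ← h] at habUV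
      simp at habUV
    · exact h
  have h1 : 0 ≤ (U - a) * (U - b) := mul_nonneg (sub_nonneg.2 haU) (sub_nonneg.2 hbU)
  nlinarith [h1, habUV, hU]

/-- **Strict four-point step, off-diagonal form**: `a, b < U`, `a·b ≤ U·V`, `a ≥ 0` ⇒
`a + b < U + V`. [ours] -/
theorem fourPoint_lt' {a b U V : ℝ} (ha : 0 ≤ a) (haU : a < U) (hbU : b < U)
    (habUV : a * b ≤ U * V) : a + b < U + V := by
  have hU : 0 < U := lt_of_le_of_lt ha haU
  have h1 : 0 < (U - a) * (U - b) := mul_pos (sub_pos.2 haU) (sub_pos.2 hbU)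
  nlinarith [h1, habUV, hU]

variable {κ : Type*} {X : Type*} [LinearOrder X]

/-- **Strict MTP₂ integrand inequality from strict DIAGONAL squares**: `F ≥ 0` jointly MTP₂ and
`F x s·F y s < F (x⊔y) s·F (x⊓y) s` for every `s` ⇒ for all `s, t`:
`F x s·F y t + F x t·F y s < F (x⊔y) s·F (x⊓y) t + F (x⊔y) t·F (x⊓y) s`. [ours] -/
theorem mtp2_integrand_lt_of_diag (F : (κ → X) → X → ℝ) (hF0 : ∀ x s, 0 ≤ F x s)
    (hF : ∀ x y s t, F x s * F y t ≤ F (x ⊔ y) (max s t) * F (x ⊓ y) (min s t)) (x y : κ → X)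
    (hdiag : ∀ s, F x s * F y s < F (x ⊔ y) s * F (x ⊓ y) s) (s t : X) :
    F x s * F y t + F x t * F y s < F (x ⊔ y) s * F (x ⊓ y) t + F (x ⊔ y) t * F (x ⊓ y) s := by
  wlog hst : s ≤ t generalizing s t
  · have h := this t s (le_of_lt (not_le.1 hst))
    linarith
  have hmax' : max t s = t := max_eq_left hst
  have hmin' : min t s = s := min_eq_right hst
  have hU1 : F x s * F y t ≤ F (x ⊔ y) t * F (x ⊓ y) s := by
    have h := hF y x t s
    rw [hmax', hmin', sup_comm, inf_comm] at h
    linarith [h]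
  have hU2 : F x t * F y s ≤ F (x ⊔ y) t * F (x ⊓ y) s := by
    have h := hF x y t s
    rw [hmax', hmin'] at h
    exact h
  have hab : (F x s * F y t) * (F x t * F y s) <
      (F (x ⊔ y) t * F (x ⊓ y) s) * (F (x ⊔ y) s * F (x ⊓ y) t) := by
    calc (F x s * F y t) * (F x t * F y s) = (F x s * F y s) * (F x t * F y t) := by ring
      _ < (F (x ⊔ y) s * F (x ⊓ y) s) * (F (x ⊔ y) t * F (x ⊓ y) t) :=
          mul_lt_mul'' (hdiag s) (hdiag t) (mul_nonneg (hF0 _ _) (hF0 _ _))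
            (mul_nonneg (hF0 _ _) (hF0 _ _))
      _ = (F (x ⊔ y) t * F (x ⊓ y) s) * (F (x ⊔ y) s * F (x ⊓ y) t) := by ring
  have h := fourPoint_lt (mul_nonneg (hF0 _ _) (hF0 _ _)) hU1 hU2 hab
  linarith

/-- **Strict MTP₂ integrand inequality from strict CROSSED terms** (`s < t`): `F ≥ 0` jointly MTP₂,
`F x s·F y t < F (x⊔y) t·F (x⊓y) s` and `F x t·F y s < F (x⊔y) t·F (x⊓y) s` ⇒ the same strict
conclusion at `(s, t)`. [ours] -/
theorem mtp2_integrand_lt_of_offdiag (F : (κ → X) → X → ℝ) (hF0 : ∀ x s, 0 ≤ F x s)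
    (hF : ∀ x y s t, F x s * F y t ≤ F (x ⊔ y) (max s t) * F (x ⊓ y) (min s t)) (x y : κ → X)
    {s t : X} (hst : s ≤ t) (h1 : F x s * F y t < F (x ⊔ y) t * F (x ⊓ y) s)
    (h2 : F x t * F y s < F (x ⊔ y) t * F (x ⊓ y) s) :
    F x s * F y t + F x t * F y s < F (x ⊔ y) s * F (x ⊓ y) t + F (x ⊔ y) t * F (x ⊓ y) s := by
  have hs : F x s * F y s ≤ F (x ⊔ y) s * F (x ⊓ y) s := by
    have h := hF x y s s
    rwa [max_self, min_self] at h
  have ht : F x t * F y t ≤ F (x ⊔ y) t * F (x ⊓ y) t := by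
    have h := hF x y t t
    rwa [max_self, min_self] at h
  have hab : (F x s * F y t) * (F x t * F y s) ≤
      (F (x ⊔ y) t * F (x ⊓ y) s) * (F (x ⊔ y) s * F (x ⊓ y) t) := by
    calc (F x s * F y t) * (F x t * F y s) = (F x s * F y s) * (F x t * F y t) := by ring
      _ ≤ (F (x ⊔ y) s * F (x ⊓ y) s) * (F (x ⊔ y) t * F (x ⊓ y) t) :=
          mul_le_mul hs ht (mul_nonneg (hF0 _ _) (hF0 _ _)) (mul_nonneg (hF0 _ _) (hF0 _ _))
      _ = (F (x ⊔ y) t * F (x ⊓ y) s) * (F (x ⊔ y) s * F (x ⊓ y) t) := by ring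
  have h := fourPoint_lt' (mul_nonneg (hF0 _ _) (hF0 _ _)) h1 h2 hab
  have _ := hst
  linarith

/-! ## §2 Strict integration step -/

variable [MeasurableSpace X]

/-- **STRICT MTP₂ UNDER INTEGRATION**: `F ≥ 0` jointly MTP₂ with integrable sections; if the
symmetrised integrand inequality (`mtp2_integrand_le`) is STRICT on a set `S ⊆ X × X` of positive
`μ ⊗ μ`-measure then `(∫ F x)(∫ F y) < (∫ F (x⊔y))(∫ F (x⊓y))`. [ours] -/
theorem mtp2_integral_lt (μ : Measure X) [SFinite μ] (F : (κ → X) → X → ℝ) (hF0 : ∀ x s, 0 ≤ F x s)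
    (hF : ∀ x y s t, F x s * F y t ≤ F (x ⊔ y) (max s t) * F (x ⊓ y) (min s t))
    (hint : ∀ x, Integrable (F x) μ) (x y : κ → X) {S : Set (X × X)} (hS : 0 < (μ.prod μ) S)
    (hlt : ∀ p ∈ S, F x p.1 * F y p.2 + F x p.2 * F y p.1 <
        F (x ⊔ y) p.1 * F (x ⊓ y) p.2 + F (x ⊔ y) p.2 * F (x ⊓ y) p.1) :
    (∫ s, F x s ∂μ) * (∫ t, F y t ∂μ) < (∫ s, F (x ⊔ y) s ∂μ) * (∫ t, F (x ⊓ y) t ∂μ) := by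
  -- the symmetrised difference integrand
  set g : X × X → ℝ := fun p =>
    (F (x ⊔ y) p.1 * F (x ⊓ y) p.2 + F (x ⊔ y) p.2 * F (x ⊓ y) p.1) -
      (F x p.1 * F y p.2 + F x p.2 * F y p.1) with hg
  have hg0 : ∀ p, 0 ≤ g p := fun p => by
    have h := mtp2_integrand_le F hF0 hF x y p.1 p.2
    simp only [hg]
    linarith [h, mul_comm (F y p.1) (F x p.2), mul_comm (F (x ⊓ y) p.1) (F (x ⊔ y) p.2)]
  have i1 : Integrable (fun p : X × X => F (x ⊔ y) p.1 * F (x ⊓ y) p.2) (μ.prod μ) :=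
    (hint _).mul_prod (hint _)
  have i2 : Integrable (fun p : X × X => F (x ⊔ y) p.2 * F (x ⊓ y) p.1) (μ.prod μ) :=
    ((hint (x ⊓ y)).mul_prod (hint (x ⊔ y))).congr (ae_of_all _ fun p => by simp only; ring)
  have i3 : Integrable (fun p : X × X => F x p.1 * F y p.2) (μ.prod μ) := (hint _).mul_prod (hint _)
  have i4 : Integrable (fun p : X × X => F x p.2 * F y p.1) (μ.prod μ) :=
    ((hint y).mul_prod (hint x)).congr (ae_of_all _ fun p => by simp only; ring)
  have i12 : Integrable (fun p : X × X =>
      F (x ⊔ y) p.1 * F (x ⊓ y) p.2 + F (x ⊔ y) p.2 * F (x ⊓ y) p.1) (μ.prod μ) := i1.add i2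
  have i34 : Integrable (fun p : X × X => F x p.1 * F y p.2 + F x p.2 * F y p.1) (μ.prod μ) :=
    i3.add i4
  have hgi : Integrable g (μ.prod μ) := by rw [hg]; exact i12.sub i34
  have hgint : ∫ p, g p ∂(μ.prod μ) =
      2 * ((∫ s, F (x ⊔ y) s ∂μ) * (∫ t, F (x ⊓ y) t ∂μ)) -
        2 * ((∫ s, F x s ∂μ) * (∫ t, F y t ∂μ)) := by
    have e1 : ∫ p : X × X, F (x ⊔ y) p.1 * F (x ⊓ y) p.2 ∂(μ.prod μ) =
        (∫ s, F (x ⊔ y) s ∂μ) * (∫ t, F (x ⊓ y) t ∂μ) := integral_prod_mul (μ := μ) (ν := μ) _ _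
    have e2 : ∫ p : X × X, F (x ⊔ y) p.2 * F (x ⊓ y) p.1 ∂(μ.prod μ) =
        (∫ s, F (x ⊔ y) s ∂μ) * (∫ t, F (x ⊓ y) t ∂μ) := by
      have h := integral_prod_mul (μ := μ) (ν := μ) (F (x ⊓ y)) (F (x ⊔ y))
      rw [mul_comm] at h
      rw [← h]
      exact integral_congr_ae (ae_of_all _ fun p => by simp only; ring)
    have e3 : ∫ p : X × X, F x p.1 * F y p.2 ∂(μ.prod μ) = (∫ s, F x s ∂μ) * (∫ t, F y t ∂μ) :=
      integral_prod_mul (μ := μ) (ν := μ) _ _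
    have e4 : ∫ p : X × X, F x p.2 * F y p.1 ∂(μ.prod μ) = (∫ s, F x s ∂μ) * (∫ t, F y t ∂μ) := by
      have h := integral_prod_mul (μ := μ) (ν := μ) (F y) (F x)
      rw [mul_comm] at h
      rw [← h]
      exact integral_congr_ae (ae_of_all _ fun p => by simp only; ring)
    simp only [hg]
    rw [integral_sub i12 i34, integral_add i1 i2, integral_add i3 i4, e1, e2, e3, e4]
    ring
  have hpos : 0 < ∫ p, g p ∂(μ.prod μ) := by
    rw [integral_pos_iff_support_of_nonneg (fun p => hg0 p) hgi]
    refine lt_of_lt_of_le hS (measure_mono fun p hp => ?_)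
    have h := hlt p hp
    simp only [Function.mem_support, hg]
    exact ne_of_gt (by linarith)
  linarith

/-! ## §3 Strict pure squares survive integrating an unrelated coordinate -/

section CoordAvg

variable [Fintype κ] [DecidableEq κ] (μ : Measure X) [IsProbabilityMeasure μ]

omit [LinearOrder X] [MeasurableSpace X] [Fintype κ] in
/-- Three `update`s at distinct coordinates commute (the integrated coordinate moved innermost).
[folklore] -/
theorem update3_comm (z : κ → X) {a j k : κ} (hka : k ≠ a) (hkj : k ≠ j) (u t s : X) :
    update (update (update z a u) j t) k s = update (update (update z k s) a u) j t := by
  rw [update_comm (Ne.symm hkj), update_comm (Ne.symm hka)]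

omit [MeasurableSpace X] [Fintype κ] in
/-- `z[a ↦ u][j ↦ t'] ⊔ z[a ↦ u'][j ↦ t] = z[a ↦ u'][j ↦ t']` for `u ≤ u'`, `t ≤ t'`, `a ≠ j`. [folklore] -/
theorem upd2_sup_upd2 (z : κ → X) {a j : κ} (haj : a ≠ j) {u u' t t' : X} (hu : u ≤ u')
    (ht : t ≤ t') :
    update (update z a u) j t' ⊔ update (update z a u') j t = update (update z a u') j t' := by
  funext i
  simp only [Pi.sup_apply]
  by_cases hij : i = j
  · subst hij; simp [sup_eq_left.2 ht]
  · by_cases hia : i = a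
    · subst hia; simp [update_of_ne hij, sup_eq_right.2 hu]
    · simp [update_of_ne hij, update_of_ne hia]

omit [MeasurableSpace X] [Fintype κ] in
/-- `z[a ↦ u][j ↦ t'] ⊓ z[a ↦ u'][j ↦ t] = z[a ↦ u][j ↦ t]` for `u ≤ u'`, `t ≤ t'`, `a ≠ j`. [folklore] -/
theorem upd2_inf_upd2 (z : κ → X) {a j : κ} (haj : a ≠ j) {u u' t t' : X} (hu : u ≤ u')
    (ht : t ≤ t') :
    update (update z a u) j t' ⊓ update (update z a u') j t = update (update z a u) j t := by
  funext i
  simp only [Pi.inf_apply]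
  by_cases hij : i = j
  · subst hij; simp [inf_eq_right.2 ht]
  · by_cases hia : i = a
    · subst hia; simp [update_of_ne hij, inf_eq_left.2 hu]
    · simp [update_of_ne hij, update_of_ne hia]

omit [LinearOrder X] in
/-- A partial average over one coordinate of a POSITIVE bounded measurable weight is positive
(reference probability measure). [ours] -/
theorem coordAvg_singleton_pos (k : κ) {w : (κ → X) → ℝ} (hwm : Measurable w) (hw0 : ∀ x, 0 < w x)
    {C : ℝ} (hwC : ∀ x, |w x| ≤ C) (x : κ → X) : 0 < coordAvg μ {k} w x := by
  rw [coordAvg_singleton_of_measurable μ k hwm]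
  have hint : Integrable (fun s => w (update x k s)) μ :=
    Integrable.mono' (integrable_const C) ((hwm.comp (measurable_update x)).aestronglyMeasurable)
      (ae_of_all _ fun s => by rw [Real.norm_eq_abs]; exact hwC _)
  rw [integral_pos_iff_support_of_nonneg (fun s => (hw0 _).le) hint]
  have hsupp : Function.support (fun s => w (update x k s)) = univ :=
    Set.eq_univ_of_forall fun s => (hw0 _).ne'
  rw [hsupp, measure_univ]
  exact one_pos

/-- **STRICT SQUARES SURVIVE INTEGRATING AN UNRELATED COORDINATE**: `w ≥ 0` bounded measurable MTP₂
with strict pure `(a, j)`-squares, `k ∉ {a, j}` ⇒ `A_k w` has strict pure `(a, j)`-squares (the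
diagonal of the symmetrised integrand is a pure square at the shifted base point, strict everywhere).
[ours] -/
theorem pureSq_coordAvg_singleton (k : κ) {w : (κ → X) → ℝ} (hwm : Measurable w)
    (hw0 : ∀ x, 0 ≤ w x) {C : ℝ} (hwC : ∀ x, |w x| ≤ C)
    (hw : ∀ x y, w x * w y ≤ w (x ⊔ y) * w (x ⊓ y)) {a j : κ} (haj : a ≠ j) (hka : k ≠ a)
    (hkj : k ≠ j)
    (hsq : ∀ z (α α' β β' : X), α < α' → β < β' →
      w (update (update z a α) j β') * w (update (update z a α') j β) <
        w (update (update z a α') j β') * w (update (update z a α) j β))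
    (z : κ → X) {α α' β β' : X} (hα : α < α') (hβ : β < β') :
    coordAvg μ {k} w (update (update z a α) j β') * coordAvg μ {k} w (update (update z a α') j β) <
      coordAvg μ {k} w (update (update z a α') j β') *
        coordAvg μ {k} w (update (update z a α) j β) := by
  have hsup := upd2_sup_upd2 z haj hα.le hβ.le
  have hinf := upd2_inf_upd2 z haj hα.le hβ.le
  have hint : ∀ x : κ → X, Integrable (fun s => w (update x k s)) μ := fun x =>
    Integrable.mono' (integrable_const C) ((hwm.comp (measurable_update x)).aestronglyMeasurable)
      (ae_of_all _ fun s => by rw [Real.norm_eq_abs]; exact hwC _)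
  have hF : ∀ (x y : κ → X) (s t : X), w (update x k s) * w (update y k t) ≤
      w (update (x ⊔ y) k (max s t)) * w (update (x ⊓ y) k (min s t)) := fun x y s t => by
    rw [← update_sup_update, ← update_inf_update]; exact hw _ _
  have hdiag : ∀ s, w (update (update (update z a α) j β') k s) *
      w (update (update (update z a α') j β) k s) <
      w (update (update (update z a α) j β' ⊔ update (update z a α') j β) k s) *
        w (update (update (update z a α) j β' ⊓ update (update z a α') j β) k s) := by
    intro s
    rw [hsup, hinf]
    simp only [update3_comm z hka hkj]
    exact hsq (update z k s) α α' β β' hα hβ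
  have key := mtp2_integral_lt μ (fun x s => w (update x k s)) (fun x s => hw0 _) hF hint
    (update (update z a α) j β') (update (update z a α') j β) (S := univ)
    (by rw [measure_univ]; exact one_pos)
    (fun p _ => mtp2_integrand_lt_of_diag (fun x s => w (update x k s)) (fun x s => hw0 _) hF _ _
      hdiag p.1 p.2)
  rw [← hsup, ← hinf]
  simp only [coordAvg_singleton_of_measurable μ k hwm]
  exact key

omit [LinearOrder X] [IsProbabilityMeasure μ] in
/-- `A_T G` does not read a coordinate inside the block `T`. [ours] -/
theorem coordAvg_update_of_mem (T : Finset κ) {a : κ} (ha : a ∈ T) (G : (κ → X) → ℝ) (ψ : κ → X)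
    (v : X) : coordAvg μ T G (update ψ a v) = coordAvg μ T G ψ := by
  unfold coordAvg
  congr 1
  funext ω'
  congr 1
  funext i
  by_cases hi : i ∈ T
  · simp [Finset.piecewise, hi]
  · have hia : i ≠ a := fun h => hi (h ▸ ha)
    simp [Finset.piecewise, hi, update_of_ne hia]

omit [LinearOrder X] in
/-- Every partial average of a POSITIVE bounded measurable weight is positive (reference probability
measure). [ours] -/
theorem coordAvg_pos (T : Finset κ) :
    ∀ {w : (κ → X) → ℝ}, Measurable w → (∀ x, 0 < w x) → (∃ C, ∀ x, |w x| ≤ C) →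
      ∀ ψ, 0 < coordAvg μ T w ψ := by
  induction T using Finset.induction_on with
  | empty => intro w _ hw0 _ ψ; simpa [coordAvg_empty] using hw0 ψ
  | insert k T hk ih =>
    intro w hwm hw0 hwC ψ
    obtain ⟨C, hC⟩ := hwC
    rw [coordAvg_insert_of_bounded μ hk hwm hC]
    obtain ⟨hm1, -, hC1⟩ := coordAvg_singleton_props μ k hwm (fun x => (hw0 x).le) hC
    exact ih hm1 (fun x => coordAvg_singleton_pos μ k hwm hw0 hC x) ⟨C, hC1⟩ ψ

end CoordAvg

/-! ## §4 The Gaussian / gradient bond is strictly TP₂ (the standard instance) -/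

/-- **The Gaussian / gradient-`φ⁴` bond `exp(−κ(u−x)²/2)` is STRICTLY TP₂ on `ℝ` for `κ > 0`**: the
log of the `2 × 2` minor ratio is `κ(u'−u)(y−x) > 0`. [ours] -/
theorem gaussianBond_stp2 {κ : ℝ} (hκ : 0 < κ) (u u' x y : ℝ) (hu : u < u') (hxy : x < y) :
    Real.exp (-(κ * (u - y) ^ 2 / 2)) * Real.exp (-(κ * (u' - x) ^ 2 / 2)) <
      Real.exp (-(κ * (u - x) ^ 2 / 2)) * Real.exp (-(κ * (u' - y) ^ 2 / 2)) := by
  rw [← Real.exp_add, ← Real.exp_add, Real.exp_lt_exp]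
  have : 0 < κ * ((u' - u) * (y - x)) := mul_pos hκ (mul_pos (sub_pos.2 hu) (sub_pos.2 hxy))
  nlinarith [this]

/-- The Gaussian / gradient bond is TP₂ (`κ ≥ 0`, weak inequalities). [ours] -/
theorem gaussianBond_tp2 {κ : ℝ} (hκ : 0 ≤ κ) (u u' x y : ℝ) (hu : u ≤ u') (hxy : x ≤ y) :
    Real.exp (-(κ * (u' - x) ^ 2 / 2)) * Real.exp (-(κ * (u - y) ^ 2 / 2)) ≤
      Real.exp (-(κ * (u - x) ^ 2 / 2)) * Real.exp (-(κ * (u' - y) ^ 2 / 2)) := by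
  rw [← Real.exp_add, ← Real.exp_add, Real.exp_le_exp]
  have : 0 ≤ κ * ((u' - u) * (y - x)) :=
    mul_nonneg hκ (mul_nonneg (sub_nonneg.2 hu) (sub_nonneg.2 hxy))
  nlinarith [this]

/-- The Gaussian bond is positive, bounded by `1`, jointly measurable (bookkeeping). [ours] -/
theorem gaussianBond_props (κ : ℝ) (hκ : 0 ≤ κ) :
    (∀ u x : ℝ, 0 < Real.exp (-(κ * (u - x) ^ 2 / 2))) ∧
      Measurable (uncurry fun u x : ℝ => Real.exp (-(κ * (u - x) ^ 2 / 2))) ∧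
      ∀ u x : ℝ, |Real.exp (-(κ * (u - x) ^ 2 / 2))| ≤ 1 := by
  refine ⟨fun u x => Real.exp_pos _, ?_, fun u x => ?_⟩
  · exact (Real.measurable_exp.comp
      ((measurable_const.mul ((measurable_fst.sub measurable_snd).pow_const 2)).div_const 2).neg)
  · rw [abs_of_pos (Real.exp_pos _), Real.exp_le_one_iff]
    have : 0 ≤ κ * (u - x) ^ 2 / 2 := by positivity
    linarith

end Summit.Ventures.LatticeQCDFlow.Theory2.Autoregressive

end
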